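import Mathlib
import Summits.Ventures.PercRepro2.RootEdgeThreeMark
import Summits.Ventures.PercRepro2.BHKEvents
import Summits.Ventures.PercRepro2.BHKAvoid
import Summits.Ventures.PercRepro2.OrderPreservation

/-!
# The signed half of (3M): `Term₂ ≥ 0` is a theorem (BHK 1.1 + BHK 1.4 with avoidance)
(blind cell PercRepro2, night-3 g22, 2026-08-28; `proofs/NIGHT3-CERT.md` §31.5)

With `Q = {a₁ ↮ a₂}`, `H = C(a₂)`, `L = C(a₁)`, `v̄ = {v ∉ H}`, the (3M)-slack splits EXACTLY as
`Λ = Term₁ + Term₂` (`threeMark_slack_split`, a ring identity in the cells) with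

  `Term₁ = P(Q,vH,bL)·P(Q,v̄,oH) − P(Q,vH,bL,oH)·P(Q,v̄)`,
  `Term₂ = P(Q,v̄,bL)·P(Q,vH,oH) − P(Q,v̄,bL,oH)·P(Q,vH)`.

**`threeMark_term2_nonneg`: `Term₂ ≥ 0`** — `P(o ∈ H | Q, v ∈ H) ≥ P(o ∈ H | Q, v ∉ H, b ∈ L)` —
by the chain `P(oH | Q, vH) ≥ P(oH | Q) ≥ P(oH | Q, v̄)` (BHK06 Thm 1.2, the cluster of `a₂` is
positively associated given `Q`: `bhk_same_cluster_events`) and `P(oH | Q, v̄) ≥ P(oH | Q, v̄, bL)`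
(BHK06 Thm 1.4 with the avoided set `{a₁, v}`: `bhk_cross_cluster_avoid`).  `Term₁` is NOT signed
(census: negative on 126 / 296 random instances), so (3M) ⟺ `Term₁ ≥ −Term₂`: the whole content of
(3M) is that the `{v ∈ H}`-world's possible positive correlation of `o ∈ H` with `b ∈ L` is dominated
by the `{v ∉ H}`-world's negative one, in the masses' normalisation.  Own work; standard axioms.
-/

namespace Summit.Ventures.PercRepro2

open UnionCluster

namespace CovForm

namespace RootEdge

variable {V : Type*} {E : Type*} [Fintype E] [DecidableEq E] [DecidableEq V]
  {R : Type*} [Field R] [LinearOrder R] [IsStrictOrderedRing R]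

omit [DecidableEq V] [LinearOrder R] [IsStrictOrderedRing R] in
/-- The (3M)-slack is `Term₁ + Term₂` (in the cells). -/
lemma threeMark_slack_split (p : E → R) (ends : E → Sym2 V) (a₁ a₂ b o v : V) :
    cell p ends a₁ a₂ b o v true false true * cell p ends a₁ a₂ b o v false true false +
        cell p ends a₁ a₂ b o v false false true * cell p ends a₁ a₂ b o v true true false -
        cell p ends a₁ a₂ b o v false true true * cell p ends a₁ a₂ b o v true false false -
        cell p ends a₁ a₂ b o v true true true * cell p ends a₁ a₂ b o v false false false =
      ((cell p ends a₁ a₂ b o v true false true + cell p ends a₁ a₂ b o v true true true) *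
          (cell p ends a₁ a₂ b o v false true false + cell p ends a₁ a₂ b o v false true true) -
        cell p ends a₁ a₂ b o v true true true *
          (cell p ends a₁ a₂ b o v false false false + cell p ends a₁ a₂ b o v false false true +
            cell p ends a₁ a₂ b o v false true false + cell p ends a₁ a₂ b o v false true true)) +
      ((cell p ends a₁ a₂ b o v false false true + cell p ends a₁ a₂ b o v false true true) *
          (cell p ends a₁ a₂ b o v true true false + cell p ends a₁ a₂ b o v true true true) -
        cell p ends a₁ a₂ b o v false true true *
          (cell p ends a₁ a₂ b o v true false false + cell p ends a₁ a₂ b o v true false true +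
            cell p ends a₁ a₂ b o v true true false + cell p ends a₁ a₂ b o v true true true)) := by
  ring

omit [Fintype E] [DecidableEq E] [LinearOrder R] [IsStrictOrderedRing R] in
/-- `{a₂ ↮ a₁, a₂ ↮ v}` as `Q′ = Q ∩ {v ∉ C(a₂)}`. -/
lemma avoidAll_pair_eq (ends : E → Sym2 V) (a₁ a₂ v : V) :
    avoidAll ends a₂ {a₁, v} = {ω' | ω' ∈ avoidAll ends a₂ {a₁} ∧ ¬ Conn ends ω' a₂ v} := by
  ext ω
  simp only [mem_avoidAll, Finset.mem_insert, Finset.mem_singleton, forall_eq_or_imp, forall_eq,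
    Set.mem_setOf_eq]

omit [Fintype E] [DecidableEq E] [DecidableEq V] [LinearOrder R] [IsStrictOrderedRing R] in
/-- `Q = {a₂ ↮ a₁}` as the complement of the connection event `a₂ ↔ a₁`. -/
lemma avoidAll_singleton_eq_compl' (ends : E → Sym2 V) (a₁ a₂ : V) :
    avoidAll ends a₂ {a₁} = (connEvent ends a₂ a₁)ᶜ := by
  ext ω
  simp only [mem_avoidAll, Finset.mem_singleton, forall_eq, Set.mem_compl_iff, mem_connEvent]

omit [DecidableEq V] in
/-- **`Term₂ ≥ 0`**: `P(Q, v̄, bL, oH) · P(Q, vH) ≤ P(Q, v̄, bL) · P(Q, vH, oH)` in the cells,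
`m(011)·(m(100) + m(101) + m(110) + m(111)) ≤ (m(001) + m(011))·(m(110) + m(111))` — BHK06 Thm 1.2
for `(v, o)` on `Q` and Thm 1.4 for `(o, b)` with the avoided set `{a₁, v}`. -/
theorem threeMark_term2_nonneg [Fintype V] (ends : E → Sym2 V) (a₁ a₂ b o v : V)
    (p : E → R) (hp : IsProbVec p) :
    cell p ends a₁ a₂ b o v false true true *
        (cell p ends a₁ a₂ b o v true false false + cell p ends a₁ a₂ b o v true false true +
          cell p ends a₁ a₂ b o v true true false + cell p ends a₁ a₂ b o v true true true) ≤
      (cell p ends a₁ a₂ b o v false false true + cell p ends a₁ a₂ b o v false true true) *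
        (cell p ends a₁ a₂ b o v true true false + cell p ends a₁ a₂ b o v true true true) := by
  classical
  -- the cells
  set c000 := cell p ends a₁ a₂ b o v false false false with hc000
  set c001 := cell p ends a₁ a₂ b o v false false true with hc001
  set c010 := cell p ends a₁ a₂ b o v false true false with hc010
  set c011 := cell p ends a₁ a₂ b o v false true true with hc011
  set c100 := cell p ends a₁ a₂ b o v true false false with hc100
  set c101 := cell p ends a₁ a₂ b o v true false true with hc101
  set c110 := cell p ends a₁ a₂ b o v true true false with hc110
  set c111 := cell p ends a₁ a₂ b o v true true true with hc111
  have hn : ∀ χ ω β : Bool, 0 ≤ cell p ends a₁ a₂ b o v χ ω β := fun χ ω β => prob_nonneg hp _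
  have n000 := hn false false false; have n001 := hn false false true
  have n010 := hn false true false; have n011 := hn false true true
  have n100 := hn true false false; have n101 := hn true false true
  have n110 := hn true true false; have n111 := hn true true true
  -- (i) BHK 1.2: `P(Q, vH) · P(Q, oH) ≤ P(Q, vH, oH) · P(Q)`
  have hi := bhk_same_cluster_events p hp ends a₂ a₁ (isUpperSet_mem_setOf v) (isUpperSet_mem_setOf o)
  rw [← connEvent_eq_clusterInEvent, ← connEvent_eq_clusterInEvent,
    ← avoidAll_singleton_eq_compl'] at hi
  have e1 : connEvent ends a₂ v ∩ avoidAll ends a₂ {a₁} =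
      avoidAll ends a₂ {a₁} ∩ connEvent ends a₂ v := Set.inter_comm _ _
  have e2 : connEvent ends a₂ o ∩ avoidAll ends a₂ {a₁} =
      avoidAll ends a₂ {a₁} ∩ connEvent ends a₂ o := Set.inter_comm _ _
  have e3 : connEvent ends a₂ v ∩ connEvent ends a₂ o ∩ avoidAll ends a₂ {a₁} =
      avoidAll ends a₂ {a₁} ∩ (connEvent ends a₂ v ∩ connEvent ends a₂ o) := by
    ext; simp only [Set.mem_inter_iff]; tauto
  rw [e1, e2, e3] at hi
  -- the masses of (i) in the cells
  have m1 : prob p (avoidAll ends a₂ {a₁} ∩ connEvent ends a₂ v) = c100 + c101 + c110 + c111 := by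
    have h := prob_inter_add_prob_inter_compl p (avoidAll ends a₂ {a₁}) (connEvent ends a₂ v)
    have e : avoidAll ends a₂ {a₁} ∩ (connEvent ends a₂ v)ᶜ =
        {ω' | ω' ∈ avoidAll ends a₂ {a₁} ∧ ¬ Conn ends ω' a₂ v} := by
      ext; simp only [Set.mem_inter_iff, Set.mem_compl_iff, mem_connEvent, Set.mem_setOf_eq]
    rw [e, mass_Q', mass_Q] at h
    linarith [h]
  have m2 : prob p (avoidAll ends a₂ {a₁} ∩ (connEvent ends a₂ v ∩ connEvent ends a₂ o)) =
      c110 + c111 := by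
    have h := prob_inter_add_prob_inter_compl p (avoidAll ends a₂ {a₁} ∩ connEvent ends a₂ o)
      (connEvent ends a₂ v)
    have e : avoidAll ends a₂ {a₁} ∩ connEvent ends a₂ o ∩ (connEvent ends a₂ v)ᶜ =
        {ω' | ω' ∈ avoidAll ends a₂ {a₁} ∧ ¬ Conn ends ω' a₂ v ∧ Conn ends ω' a₂ o} := by
      ext; simp only [Set.mem_inter_iff, Set.mem_compl_iff, mem_connEvent, Set.mem_setOf_eq]; tauto
    have e' : avoidAll ends a₂ {a₁} ∩ connEvent ends a₂ o ∩ connEvent ends a₂ v =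
        avoidAll ends a₂ {a₁} ∩ (connEvent ends a₂ v ∩ connEvent ends a₂ o) := by
      ext; simp only [Set.mem_inter_iff]; tauto
    rw [e, e', mass_Q'oH, mass_oH] at h
    linarith [h]
  rw [m1, m2, mass_oH, mass_Q] at hi
  -- (iii) BHK 1.4 with the avoided set `{a₁, v}`:
  -- `P(Q′, oH, bL) · P(Q′) ≤ P(Q′, oH) · P(Q′, bL)`
  have hiii := bhk_cross_cluster_avoid p hp ends a₂ a₁ (X := {a₁, v})
    (Finset.mem_insert_self a₁ {v}) (isUpperSet_mem_setOf o) (isUpperSet_mem_setOf b)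
  rw [← connEvent_eq_clusterInEvent, ← connEvent_eq_clusterInEvent, avoidAll_pair_eq] at hiii
  have f1 : connEvent ends a₂ o ∩ connEvent ends a₁ b ∩
      {ω' | ω' ∈ avoidAll ends a₂ {a₁} ∧ ¬ Conn ends ω' a₂ v} =
      {ω' | ω' ∈ avoidAll ends a₂ {a₁} ∧ ¬ Conn ends ω' a₂ v ∧ Conn ends ω' a₂ o ∧
        Conn ends ω' a₁ b} := by
    ext; simp only [Set.mem_inter_iff, mem_connEvent, Set.mem_setOf_eq]; tauto
  have f2 : connEvent ends a₂ o ∩ {ω' | ω' ∈ avoidAll ends a₂ {a₁} ∧ ¬ Conn ends ω' a₂ v} =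
      {ω' | ω' ∈ avoidAll ends a₂ {a₁} ∧ ¬ Conn ends ω' a₂ v ∧ Conn ends ω' a₂ o} := by
    ext; simp only [Set.mem_inter_iff, mem_connEvent, Set.mem_setOf_eq]; tauto
  have f3 : connEvent ends a₁ b ∩ {ω' | ω' ∈ avoidAll ends a₂ {a₁} ∧ ¬ Conn ends ω' a₂ v} =
      {ω' | ω' ∈ avoidAll ends a₂ {a₁} ∧ ¬ Conn ends ω' a₂ v ∧ Conn ends ω' a₁ b} := by
    ext; simp only [Set.mem_inter_iff, mem_connEvent, Set.mem_setOf_eq]; tauto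
  rw [f1, f2, f3, mass_Q'oHbL, mass_Q', mass_Q'oH, mass_Q'bL] at hiii
  -- `E · (A·B − C·D) ≥ 0` with `E = P(Q′)`, then divide
  have hD : 0 ≤ c100 + c101 + c110 + c111 := by linarith
  have h1 := mul_le_mul_of_nonneg_left hiii hD
  have h2 := mul_nonneg (add_nonneg n001 n011) (sub_nonneg.mpr hi)
  have key : 0 ≤ (c011 + c010 + c001 + c000) *
      ((c001 + c011) * (c110 + c111) - c011 * (c100 + c101 + c110 + c111)) := by
    have hid : (c011 + c010 + c001 + c000) *
        ((c001 + c011) * (c110 + c111) - c011 * (c100 + c101 + c110 + c111)) =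
        (c001 + c011) * ((c110 + c111) *
            (c111 + c110 + c101 + c100 + c011 + c010 + c001 + c000) -
          (c100 + c101 + c110 + c111) * (c111 + c110 + c011 + c010)) +
        ((c100 + c101 + c110 + c111) * ((c011 + c010) * (c011 + c001)) -
          (c100 + c101 + c110 + c111) * (c011 * (c011 + c010 + c001 + c000))) := by ring
    rw [hid]
    linarith [h1, h2]
  rcases (add_nonneg (add_nonneg (add_nonneg n011 n010) n001) n000).eq_or_lt with hE | hE
  · -- `P(Q′) = 0` forces `m(011) = 0`
    have h011 : c011 = 0 := by linarith
    rw [h011]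
    nlinarith [n001, n110, n111]
  · exact sub_nonneg.mp (nonneg_of_mul_nonneg_right key hE)

end RootEdge

end CovForm

end Summit.Ventures.PercRepro2
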